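import Summits.BirchSwinnertonDyer.BirchSwinnertonDyer.Theorems.ByReductionTypeAtTwoGoodOrdTowerLayerField
import Summits.BirchSwinnertonDyer.BirchSwinnertonDyer.Theorems.ByReductionTypeAtTwoGoodOrdTowerLattice
import HarnessLib

/-!
# Route `ByReductionTypeAtTwo`, item `OrdKatoHalfAtTwo` (stmt-BirchSwinnertonDyer-19271), TOWER road, the
# GOOD-ORDINARY local constant at `v ∣ 2`: KERNEL BRICK G6c — LUTZ AT THE LAYER:
# `#(E₁(K̄_v)^H / p) = (𝒪_v : p)^{[K̄_v^H : K_v]} · #E₁(K̄_v)^H[p]` for every subgroup `H ≤ Γ_{K_v}` of finite index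

HONEST FRAMING (cell `bsd-2adic`, run/shared/lean/pub/bsd-2adic/, seat `bsd-2adic-tower-1` GEN 11, HUMAN RULINGS
D-0036 / D-0054 / D-0074): TOOL theorem only (no definition, no named fact, no `sorry`); closes nothing by itself;
nothing booked; BSD is not proved by any of this. This is the WALL (M4) of the scope memo
HOME/tower/SCOPE-hS34-layer-kernel-at-2-GEN7.md §3 («Lutz at the layer», there sized 1.0–1.8 kLoC, API risk HIGH) for the
KERNELISATION of the consumed projection `#𝒦_{v,n}[2^∞][2] ≤ 4` of the PRINT binder
`hS34 = Greenberg1999.lemma34_localTowerKerPrimary_cyclicExtension_rat` (Greenberg, LNM 1716, §3 Lemma 3.4 / Prop. 2.5):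
the count `#(E₁(L_n)/2E₁(L_n)) = 2^{2^n} · #E₁(L_n)[2]` at the local layer `L_n = K̄_v^{H_n}` of the cyclotomic `ℤ₂`-tower
(`[L_n : ℚ₂] = 2^n`, GEN 8 `MultTowerNS2.finrank_fixedField_localSubgroup_layerSubgroup`), which cancels the degree factor
of the local Euler–Poincaré characteristic in `#H¹(H_n, E₁[2])` (BRICK G3's Kummer count).

* **`natCard_quotient_nsmul_fixedKernel_eq`** — for a number field `K`, a finite place `v` over the prime `p`, the spectral
  valuation `w` of `K̄_v`, `W/K` with `W ⊗ K̄_v` integral and elliptic, `H ≤ Γ_{K_v}` with `L = K̄_v^H` finite over `K_v`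
  (and `W ⊗ L` integral for `w|_L`), and the subgroup `A_H` of `E(K̄_v)` of `H`-fixed points of the kernel of reduction
  `E₁(K̄_v) = kernel w (W ⊗ K̄_v)`: `A_H/pA_H` and `A_H[p]` are finite and
  `#(A_H/pA_H) = #(𝒪_v/p𝒪_v)^{[L:K_v]} · #A_H[p]`.
  Proof: `A_H ≅ E₁(L)` (BRICK G6a `exists_addEquiv_kernel_fixedField`); the tree's generic engine
  `FormalGroupChart.relIndex_map_nsmul_kernelLevel_eq` over the COMPLETE field `L` (inputs: G6a's
  `exists_limit_of_geometric_fixedField`, `exists_mem_kernel_zCoord_eq_fixedField`) gives a torsion-free finite-index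
  level `U_ρ ≤ E₁(L)` with `[U_ρ : pU_ρ] = [B_ρ(L) : B_{|p|ρ}(L)]`, which is `#(𝒪_v/p)^{[L:K_v]}` by BRICK G6b
  `exists_relIndex_ball_eq_pow` (coordinate lattices; `ρ = |p|^m`); Herbrand's identity `LocalPoints.index_range_nsmul_eq`.

References: J. Silverman, *AEC* (2009), VII.6.3, VII.2.2, IV.3.2, IV.6.4; J. Milne, *ADT* (2006), I Lemma 3.3; R. Greenberg,
LNM 1716 (1999), §2 Prop. 2.5, §3 Lemma 3.4; scope memo §3 (M4).
-/

set_option autoImplicit false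
-- the Theorems namespace of this sub repeats the summit name by design (D-0017 nested layout: Summit.<S>.<Sub>)
set_option linter.dupNamespace false

noncomputable section

open scoped Classical NNReal

universe u

namespace Summit.BirchSwinnertonDyer.BirchSwinnertonDyer.Theorems.GoodOrdTower

/-! ### Lutz at the layer: `#(E₁(K̄_v)^H / p) = (𝒪_v : p)^{[K̄_v^H : K_v]} · #E₁(K̄_v)^H[p]` -/

section Lutz

open NumberField IsDedekindDomain IsDedekindDomain.HeightOneSpectrum Field Literature.NumberTheory.EllipticCurves
  Literature.NumberTheory.EllipticCurves.FormalGroupChart Literature.NumberTheory.GaloisRepresentations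
  WeierstrassCurve

variable {K : Type u} [Field K] [NumberField K] {v : HeightOneSpectrum (𝓞 K)}
  {w : Valuation (AlgebraicClosure (v.adicCompletion K)) ℝ≥0}
  (hw : ∀ x, (w x : ℝ) = spectralNorm (v.adicCompletion K) (AlgebraicClosure (v.adicCompletion K)) x)

include hw in
/-- **Lutz at the layer** (Silverman VII.6.3 / Milne I Lemma 3.3 for the formal group over the fixed field of an open
subgroup): for `W/K` with `W ⊗ K̄_v` integral and elliptic, a prime `p` under `v`, `H ≤ Γ_{K_v}` with `L = K̄_v^H` finite
over `K_v`, and the subgroup `A_H = E₁(K̄_v)^H` of `E(K̄_v)` (points of the kernel of reduction `kernel w (W ⊗ K̄_v)` fixed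
by `H`): `A_H/pA_H` and `A_H[p]` are finite and `#(A_H/pA_H) = #(𝒪_v/p𝒪_v)^{[L:K_v]} · #A_H[p]`. Proof:
`A_H ≅ E₁(L)` (`exists_addEquiv_kernel_fixedField`); the tree's engine `FormalGroupChart.relIndex_map_nsmul_kernelLevel_eq`
over the complete field `L` (inputs `exists_limit_of_geometric_fixedField`, `exists_mem_kernel_zCoord_eq_fixedField`) gives
a torsion-free finite-index level `U_ρ ≤ E₁(L)` with `[U_ρ : pU_ρ] = [B_ρ(L) : B_{|p|ρ}(L)]`, which is
`#(𝒪_v/p)^{[L:K_v]}` by the lattice count `exists_relIndex_ball_eq_pow`; Herbrand's identity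
(`LocalPoints.index_range_nsmul_eq`) concludes. [cite: SilvermanAEC2009, Prop. VII.6.3] [cite: MilneADT2006, I Lemma 3.3] -/
theorem natCard_quotient_nsmul_fixedKernel_eq {p : ℕ} [hp : Fact p.Prime] (hpv : (p : 𝓞 K) ∈ v.asIdeal)
    (W : WeierstrassCurve K)
    [hV : (W.baseChange (AlgebraicClosure (v.adicCompletion K))).IsIntegral w.integer]
    [(W.baseChange (AlgebraicClosure (v.adicCompletion K))).IsElliptic]
    (H : Subgroup (absoluteGaloisGroup (v.adicCompletion K)))
    [FiniteDimensional (v.adicCompletion K) (IntermediateField.fixedField H)]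
    [hVL : (W.baseChange (IntermediateField.fixedField H)).IsIntegral
      (w.comap (algebraMap (IntermediateField.fixedField H) (AlgebraicClosure (v.adicCompletion K)))).integer]
    (AH : AddSubgroup (localPoints W (v.adicCompletion K)))
    (hAH : ∀ Q : localPoints W (v.adicCompletion K), Q ∈ AH ↔
      (Q : (W.baseChange (AlgebraicClosure (v.adicCompletion K))).toAffine.Point) ∈
          kernel w (W.baseChange (AlgebraicClosure (v.adicCompletion K))) ∧
        ∀ σ ∈ H, σ • Q = Q) :
    Finite (AH ⧸ (nsmulAddMonoidHom p : AH →+ AH).range) ∧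
      Finite (nsmulAddMonoidHom p : AH →+ AH).ker ∧
      Nat.card (AH ⧸ (nsmulAddMonoidHom p : AH →+ AH).range) =
        Nat.card (v.adicCompletionIntegers K ⧸ Ideal.span {(p : v.adicCompletionIntegers K)}) ^
            Module.finrank (v.adicCompletion K) (IntermediateField.fixedField H) *
          Nat.card (nsmulAddMonoidHom p : AH →+ AH).ker := by
  -- one `DecidableEq` on the field of definition of the points: the classical one baked into `FormalGroupChart.kernel`
  letI : DecidableEq (IntermediateField.fixedField H) := fun a b ↦ Classical.propDecidable _
  -- notation
  let Kv := v.adicCompletion K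
  let Ω := AlgebraicClosure Kv
  let L : IntermediateField Kv Ω := IntermediateField.fixedField H
  let wL : Valuation L ℝ≥0 := w.comap (algebraMap L Ω)
  let VL := W.baseChange L
  have hpp : p.Prime := hp.out
  have hp0 : p ≠ 0 := hpp.ne_zero
  haveI : CharZero Kv := charZero_of_injective_algebraMap (algebraMap K Kv).injective
  haveI : CharZero L := charZero_of_injective_algebraMap (algebraMap Kv L).injective
  have hwLapp : ∀ x : L, wL x = w (x : Ω) := fun _ ↦ rfl
  have hwLspec : ∀ x : L, (wL x : ℝ) = spectralNorm Kv L x := fun x ↦ coe_valuation_comap_fixedField_eq hw L x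
  -- `|p|` in `K_v`, `L`
  have hπ1 : (NormedField.valuation : Valuation Kv ℝ≥0) (p : Kv) < 1 := LocalPoints.valuation_natCast_lt_one v hpv
  have hπ1' : ‖(p : Kv)‖ < 1 := by
    have h := hπ1; rwa [NormedField.valuation_apply, ← NNReal.coe_lt_coe, coe_nnnorm, NNReal.coe_one] at h
  have hπ0' : 0 < ‖(p : Kv)‖ := norm_pos_iff.mpr (Nat.cast_ne_zero.mpr hp0)
  have hpL : wL (p : L) = ‖(p : Kv)‖₊ := by
    apply NNReal.coe_injective
    rw [hwLspec, coe_nnnorm, show ((p : ℕ) : L) = algebraMap Kv L (p : Kv) from (map_natCast _ p).symm,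
      spectralNorm_extends]
  have hunit : ∀ n : ℕ, ¬ p ∣ n → wL (n : L) = 1 := fun n hn ↦ by
    rw [hwLapp]
    have : (((n : ℕ) : L) : Ω) = (n : Ω) := map_natCast (algebraMap L Ω) n
    rw [this]
    exact spectralValuation_natCast_eq_one_of_not_dvd hpv hw hn
  -- the count of balls in `K_v`: `[B_1 : B_{|p|}] = #(𝒪_v/p)`
  have hq : ((NormedField.valuation : Valuation Kv ℝ≥0).leAddSubgroup ‖(p : Kv)‖₊).relIndex
      ((NormedField.valuation : Valuation Kv ℝ≥0).leAddSubgroup 1) =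
      Nat.card (v.adicCompletionIntegers K ⧸ Ideal.span {(p : v.adicCompletionIntegers K)}) := by
    have h := LocalPoints.relIndex_leAddSubgroup_eq v (c := (1 : Kv)) one_ne_zero hp0
      (s := ‖(p : Kv)‖₊) (t := 1) (by rw [map_one]) (by rw [map_one, mul_one, NormedField.valuation_apply])
    exact h
  have hq0 : ((NormedField.valuation : Valuation Kv ℝ≥0).leAddSubgroup ‖(p : Kv)‖₊).relIndex
      ((NormedField.valuation : Valuation Kv ℝ≥0).leAddSubgroup 1) ≠ 0 := by
    rw [hq]; exact LocalPoints.card_quotient_span_natCast_ne_zero v hp0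
  -- the lattice count in `L`
  letI hKvnn : NontriviallyNormedField Kv := Valued.toNontriviallyNormedField Kv (WithZero (Multiplicative ℤ))
  obtain ⟨m, hm, hidx, hfinball⟩ := exists_relIndex_ball_eq_pow (K := Kv) (L := L) hwLspec hπ0' hπ1' hq0
  set ρ : ℝ≥0 := ‖(p : Kv)‖₊ ^ m with hρ
  have hρp : ρ < wL (p : L) := by
    rw [hpL, hρ]
    have h1 : ‖(p : Kv)‖₊ < 1 := by rw [← NNReal.coe_lt_coe, coe_nnnorm]; exact hπ1'
    have h0 : 0 < ‖(p : Kv)‖₊ := by rw [← NNReal.coe_pos, coe_nnnorm]; exact hπ0'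
    calc ‖(p : Kv)‖₊ ^ m < ‖(p : Kv)‖₊ ^ 1 := pow_lt_pow_right_of_lt_one₀ h0 h1 hm
      _ = ‖(p : Kv)‖₊ := pow_one _
  have hρ1 : ρ < 1 := hρp.trans_le (by rw [hpL, ← NNReal.coe_le_coe, coe_nnnorm]; exact hπ1'.le)
  -- the engine over `L`
  have hcomplete := exists_limit_of_geometric_fixedField hw L
  have hlift : ∀ a : L, wL a ≤ ρ → ∃ P ∈ kernel wL VL, P.zCoord = a := fun a ha ↦
    exists_mem_kernel_zCoord_eq_fixedField hw W H (ha.trans_lt hρ1)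
  have hengine := relIndex_map_nsmul_kernelLevel_eq (w := wL) (V := VL) hpp hunit hcomplete hp0 hρp hlift
  rw [hpL, hidx] at hengine
  -- the level `U = U_ρ ≤ E₁(L)`: torsion-free, of finite index
  let E₁ : AddSubgroup VL.toAffine.Point := kernel wL VL
  let U : AddSubgroup VL.toAffine.Point := kernelLevel wL VL ρ
  have hUE : U ≤ E₁ := kernelLevel_le_kernel ρ
  have hUtf : ∀ P ∈ U, p • P = 0 → P = 0 := fun P hP h ↦
    eq_zero_of_nsmul_eq_zero (w := wL) (V := VL) hpp hunit hp0 hP.1 (hP.2.trans_lt hρp) h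
  haveI : Finite ((wL.leAddSubgroup 1) ⧸ (wL.leAddSubgroup ρ).addSubgroupOf (wL.leAddSubgroup 1)) := by
    haveI : ((wL.leAddSubgroup ρ).addSubgroupOf (wL.leAddSubgroup 1)).FiniteIndex := ⟨hfinball⟩
    exact AddSubgroup.finite_quotient_of_finiteIndex
  have hUidx : U.relIndex E₁ ≠ 0 :=
    relIndex_kernelLevel_ne_zero (w := wL) (V := VL) (H := E₁) le_rfl (t := 1)
      (fun P hP ↦ (val_zCoord_lt_one (w := wL) hP).le) ρ
  -- Herbrand in `G = E₁(L)`
  let A : AddSubgroup E₁ := U.addSubgroupOf E₁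
  haveI : A.FiniteIndex := ⟨hUidx⟩
  have hAtf : ∀ a ∈ A, p • a = 0 → a = 0 := fun a ha h ↦
    Subtype.ext (hUtf _ (AddSubgroup.mem_addSubgroupOf.mp ha) (by
      rw [← AddSubgroup.coe_nsmul, h, ZeroMemClass.coe_zero]))
  have hherb := LocalPoints.index_range_nsmul_eq A p hAtf
  -- `[A : pA]` in `E₁(L)` is `[U : pU]` in `E(L)`
  have hrel : (A.map (nsmulAddMonoidHom p : E₁ →+ E₁)).relIndex A =
      (U.map (nsmulAddMonoidHom p : VL.toAffine.Point →+ _)).relIndex U := by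
    have hinj : Function.Injective E₁.subtype := E₁.subtype_injective
    rw [← AddSubgroup.relIndex_map_map_of_injective _ _ hinj, AddSubgroup.map_map]
    have hA : A.map E₁.subtype = U := by
      rw [AddSubgroup.addSubgroupOf_map_subtype, inf_eq_left.mpr hUE]
    have hcomm : E₁.subtype.comp (nsmulAddMonoidHom p : E₁ →+ E₁) =
        (nsmulAddMonoidHom p : VL.toAffine.Point →+ _).comp E₁.subtype := by
      ext x; simp
    rw [hcomm, ← AddSubgroup.map_map, hA]
  rw [hrel, hengine, hq] at hherb
  haveI hkerfin : Finite (nsmulAddMonoidHom p : E₁ →+ E₁).ker := LocalPoints.finite_ker_nsmul A p hAtf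
  have hcardE : Nat.card (E₁ ⧸ (nsmulAddMonoidHom p : E₁ →+ E₁).range) =
      Nat.card (v.adicCompletionIntegers K ⧸ Ideal.span {(p : v.adicCompletionIntegers K)}) ^
          Module.finrank Kv L * Nat.card (nsmulAddMonoidHom p : E₁ →+ E₁).ker := by
    rw [← AddSubgroup.index]; exact hherb
  -- transport to `A_H`
  obtain ⟨e, -⟩ := exists_addEquiv_kernel_fixedField (w := w) W H AH hAH
  obtain ⟨hq', hk'⟩ := natCard_quotient_range_nsmul_congr e p
  rw [hq', hk'] at hcardE
  haveI : Finite (nsmulAddMonoidHom p : AH →+ AH).ker := Nat.finite_of_card_ne_zero (by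
    rw [← hk']; exact Nat.card_pos.ne')
  refine ⟨Nat.finite_of_card_ne_zero ?_, inferInstance, hcardE⟩
  rw [hcardE]
  exact mul_ne_zero (pow_ne_zero _ (LocalPoints.card_quotient_span_natCast_ne_zero v hp0)) Nat.card_pos.ne'

end Lutz

end Summit.BirchSwinnertonDyer.BirchSwinnertonDyer.Theorems.GoodOrdTower

end
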